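import Summits.QuantumFields.BalabanUV.Beta.D1BFx.CornerJRankOne
import Summits.QuantumFields.BalabanUV.Beta.D1BFx.RdotBlockRange

/-!
# `BalabanUV.Beta.D1BFx.CornerVBlockRank` — road «BF-x» for binder row D1, slot (REST′), rows A3.a′∕A3.b′, STRUCTURE ITEMS (ii)+(iii) of owner
# ruling ρ-g6-13 (2) JOINED: THE AVERAGING SLOT OF THE `V`-CORNER IS RANK TWO PER BOND, RANK ONE ON THE ROAD, AND SHARES ITS NEEDLE ROW WITH
# THE `Q̇`-CORNER — `qAnti = 1_B ⊗ f − f ⊗ 1_B`, `cornerV G P qAnti = (RG·1_B) ⊗ (fP) − (RG·f) ⊗ (1_B·P)`, and on the road (`G = Ggh`, `P = Pgt`)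
# the first pair dies by this lineage's `RdotBlockRange.sum_B_RG_eq_zero`

HONEST DEPENDENCY (page 1, mandatory): continuum YM on T⁴ ⇐ BetaPertH ∧ nine spine estimates (0/9 proved); BetaPertH ⇐ (D1) ∧ (D4) ∧
CAP+tail; G-an2-4 gates asym, D1 and NE2/3/4.  HONEST FRAMING (cell contract, verbatim): «discharging `BetaPertH` makes Bałaban's UV
stability UNCONDITIONAL — a real constructive-QFT result; it is NOT the continuum limit and NOT the Clay problem.»  THIS MODULE DISCHARGES
NOTHING of the wall: [folklore] finite-sum bookkeeping over the typer's `GhostStencil` (`qJet`, `qAnti`, `ghCur`, `Sgh`), leaf-07-g2's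
`RProjectorJet` (`RG`, `cornerV`, `cornerJ`, `Jq`, `rdotOf`, `Rdot`), this lineage's `RdotBlockRange.sum_B_RG_eq_zero` (g5) and `CornerJRankOne` (g6)
BY NAME; no `def`, no `def … : Prop`, nothing cited, 0 sorry.  0 wall binders; NOT the (REST′) word bounds, NOT (K), NOT D1, NOT `BetaPertH`,
NOT continuum, NOT Clay.

LITERAL NOTE (row-D1 owner R-D1-g25-1 ∕ road owner ρ-g7-2 (d), 2026-08-21): these are the COMB-TERM (`σ = id`) needles; for the permutation-symmetrised
literal of record `JsB12Sym` the first-order averaging jet is the `S_D`-mean of the `D!` permuted needles (linear), so every identity below applies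
summand by summand.

ABSOLUTE RULE (cell charter, verbatim): «No internally-minted statement may enter as a cited fact. Every hypothesis is either kernel-proved in
this package or a verbatim quotation of a PUBLISHED theorem with page reference. The manuscript(s) under audit are NOT citable for their own
disputed steps — they are the thing under adjudication; programme-internal (2001/route/tribunal) claims are never citable.»

WHY (owner ruling ρ-g6-13 (2): «(ii) `RdotBlockRange.sum_B_RG_eq_zero` (p231378) killing one Q-pair, (iii) the Jq-corner as an explicit
rank-1-per-face-bond operator»; this lineage's BLK-NUM located structure: «K-corner face-neutral, Q-corner negligible, all growth in `cornerJ = RG∘Jq`»).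
The `V`-slot of `Rdot` is `Sgh n cK cQ κ′ u = cK·ghCur κ′ u + cQ·qAnti n κ′ u`; its averaging part `qAnti(x,z) = qJet(blk x, z) − qJet(blk z, x)` is,
by the block guard of `qJet`, the antisymmetrised tensor product `1_B(x)·f(z) − 1_B(z)·f(x)` of the INDICATOR `1_B` of the bond's block and the NEEDLE
ROW `f = qJet n κ′ u (blk u) ·` of `AveragingJetNeedle`∕`CornerJRankOne`.  Hence for ANY fine kernels `G`, `P` the `V`-corner over the averaging slot is
rank two with explicit factors, and on the road's instance `(Ggh, Pgt)` the `1_B`-pair vanishes (`R·G′` annihilates block indicators), leaving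
`−(RG·f)(x) · (1_B·Pgt)(q)`: the SAME needle row as the `Q̇`-corner `cornerJ`, against the column `Σ_{z ∈ B} Pgt(z,q)` instead of `kerP(q, blk u)`.
So every averaging-slot term of `Rdot` is (needle row) ⊗ (block-localised coarse column), and the two corners may be COMBINED row-wise.

CONTENT (all [folklore]; `B := B6QGQLower276.B (n−1) (blk (n−1) u)` the bond's block, `f := qJet n κ′ u (blk (n−1) u)`):
* §1 `qJet_blk_eq` (freeze the block label to `blk u` at the price of the indicator), **`qAnti_eq_rankTwo`**.
* §2 **`comp_qAnti_apply`** — `(A∘qAnti)(x,z) = (Σ_{y∈B} A(x,y))·f(z) − 1_B(z)·Σ_{y∈B} A(x,y)·f(y)` for ANY left factor `A`.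
* §3 **`cornerV_qAnti_apply`** — `cornerV G P qAnti (x,q) = (Σ_{y∈B} RG(x,y))·(Σ_{z∈B} f(z)·P(z,q)) − (Σ_{y∈B} RG(x,y)·f(y))·(Σ_{z∈B} P(z,q))` (rank two, generic).
* §4 ON THE ROAD (`0 < a`): **`cornerV_qAnti_apply_road`** — `cornerV (Ggh n a) (Pgt n a) (qAnti n κ′ u) x q = −(Σ_{y∈B} RG(x,y)·f(y))·(Σ_{z∈B} Pgt(z,q))`
  (rank ONE; (ii) kills the other pair), and **`cornerV_qAnti_sub_cornerJ_road`** — the two `Q̇`-slot corners COMBINE: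
  `cornerV … qAnti (x,q) − cornerJ … (Jq n a κ′ u) (x,q) = (Σ_{y∈B} RG(x,y)·f(y)) · (kerP (n−1) a q (blk u) − Σ_{z∈B} Pgt n a z q)`.
* §5 **`cornerV_Sgh_apply`** — linearity of the `V`-corner in the stencil: `cornerV G P (Sgh n cK cQ κ′ u) = cK·cornerV G P (ghCur κ′ u) + cQ·cornerV G P (qAnti n κ′ u)`
  entrywise (both slots finitely supported, so the `tsum`s of `comp` are finite sums — no decay hypothesis).
* §6 `comp_ghCur_apply`, **`cornerV_ghCur_apply`** (the ghost-kinetic corner is a DIPOLE `RG(x,u+e_κ′)·P(u,q) − RG(x,u)·P(u+e_κ′,q)`) and the capstone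
  **`Rdot_apply_road`**: `Rdot n a cK cQ κ′ u (x,q) = cK·(D(x,q) − D(q,x)) − row(x)·(cQ·colP(q) − kerP(q, blk u)) + row(q)·(cQ·colP(x) − kerP(x, blk u))`
  — one dipole plus ONE needle row against ONE combined coarse column, antisymmetrised.
Provenance: D1 formalisation swarm, unit b2b-balaban-beta-d1-formalise-leaf-04 gen 6 (prover-b2b-balaban-beta-d1-formalise-leaf-04-g6-0), 2026-08-21;
sub-leaf «D1-BFx-A3a′-NEEDLE» of `LEAVES-BFx.md` (FILE 3).
-/

namespace Summit.QuantumFields.BalabanUV.Beta.D1BFx.CornerVBlockRank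

open Finset
open scoped BigOperators
open Literature.MathematicalPhysics.QuantumFieldTheory.Balaban1983to89
open Literature.MathematicalPhysics.QuantumFieldTheory.Balaban1983to89.Beta
open B6QGQLower276 (blk B mem_B)
open ExpKernelCalculus (Site MKer comp)
open AffineAveraging (unitVec)
open Summit.QuantumFields.BalabanUV.Beta.TameKernelCalculus (trK trK_apply)
open RProjector (kerP Pgt)
open GhostLeg (Ggh)
open GhostStencil (qJet qJet_eq_zero qAnti qAnti_apply ghCur ghCur_apply Sgh Sgh_apply)
open RProjectorJet (Jq RG cornerV cornerJ)
open RdotBlockRange (sum_B_RG_eq_zero)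
open CornerJRankOne (cornerJ_apply_eq)

noncomputable section

variable (n : ℕ) [NeZero n] (a : ℝ) (κ' : Fin 4) (u : Site 4)

/-! ## §1 The averaging jet is an antisymmetrised tensor product on the bond's block -/

omit [NeZero n] in
/-- [folklore] Freezing the block label: `qJet n κ′ u (blk x) z = 1_B(x) · qJet n κ′ u (blk u) z` (the guard `blk u = blk x` as an indicator). -/
theorem qJet_blk_eq (x z : Site 4) :
    qJet n κ' u (blk (n - 1) x) z = (if blk (n - 1) x = blk (n - 1) u then 1 else 0) * qJet n κ' u (blk (n - 1) u) z := by
  by_cases h : blk (n - 1) x = blk (n - 1) u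
  · rw [h, if_pos rfl, one_mul]
  · rw [if_neg h, zero_mul, qJet_eq_zero κ' u n (fun hh => h hh.2.symm)]

omit [NeZero n] in
/-- [folklore] **`qAnti` IS RANK TWO**: `qAnti n κ′ u x z = 1_B(x)·f(z) − 1_B(z)·f(x)` with `1_B` the indicator of the bond's block and
`f = qJet n κ′ u (blk u)` the needle row. -/
theorem qAnti_eq_rankTwo (x z : Site 4) (v w : Unit) :
    qAnti n κ' u x z v w =
      (if blk (n - 1) x = blk (n - 1) u then 1 else 0) * qJet n κ' u (blk (n - 1) u) z
        - (if blk (n - 1) z = blk (n - 1) u then 1 else 0) * qJet n κ' u (blk (n - 1) u) x := by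
  rw [qAnti_apply, qJet_blk_eq n κ' u x z, qJet_blk_eq n κ' u z x]

/-! ## §2 Left composition with any fine kernel -/

omit [NeZero n] in
/-- [folklore] Off the bond's block every summand of `A∘qAnti` vanishes. -/
theorem summand_qAnti_eq_zero (A : MKer 4 Unit) (x z : Site 4) (v w : Unit) {y : Site 4} (hy : y ∉ B (n - 1) (blk (n - 1) u)) :
    A x y v () * qAnti n κ' u y z () w = 0 := by
  have hy' : ¬ blk (n - 1) y = blk (n - 1) u := fun h => hy (mem_B.2 h)
  rw [qAnti_eq_rankTwo, if_neg hy', zero_mul, qJet_eq_zero κ' u n (y := blk (n - 1) u) (x := y) (fun h => hy' h.1), mul_zero,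
    sub_zero, mul_zero]

omit [NeZero n] in
/-- [folklore] **LEFT COMPOSITION**: for ANY fine kernel `A`,
`(A∘qAnti)(x,z) = (Σ_{y ∈ B} A(x,y))·f(z) − 1_B(z)·(Σ_{y ∈ B} A(x,y)·f(y))` — the `tsum` of `comp` collapses to the bond's block. -/
theorem comp_qAnti_apply (A : MKer 4 Unit) (x z : Site 4) (v w : Unit) :
    comp A (qAnti n κ' u) x z v w =
      (∑ y ∈ B (n - 1) (blk (n - 1) u), A x y v ()) * qJet n κ' u (blk (n - 1) u) z
        - (if blk (n - 1) z = blk (n - 1) u then 1 else 0) *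
            ∑ y ∈ B (n - 1) (blk (n - 1) u), A x y v () * qJet n κ' u (blk (n - 1) u) y := by
  unfold comp
  simp only [Finset.univ_unique, PUnit.default_eq_unit, Finset.sum_singleton]
  rw [tsum_eq_sum (s := B (n - 1) (blk (n - 1) u)) (fun y hy => summand_qAnti_eq_zero n κ' u A x z v w hy)]
  have e : ∀ y ∈ B (n - 1) (blk (n - 1) u), A x y v () * qAnti n κ' u y z () w =
      A x y v () * qJet n κ' u (blk (n - 1) u) z
        - (if blk (n - 1) z = blk (n - 1) u then 1 else 0) * (A x y v () * qJet n κ' u (blk (n - 1) u) y) := by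
    intro y hy
    rw [qAnti_eq_rankTwo, if_pos (mem_B.1 hy)]
    ring
  rw [Finset.sum_congr rfl e, Finset.sum_sub_distrib, Finset.sum_mul, Finset.mul_sum]

/-! ## §3 The `V`-corner over the averaging slot: rank two for any `G`, `P` -/

omit [NeZero n] in
/-- [folklore] Off the bond's block every summand of the outer composition vanishes. -/
theorem outer_summand_eq_zero (G P : MKer 4 Unit) (x q : Site 4) (v w : Unit) {z : Site 4} (hz : z ∉ B (n - 1) (blk (n - 1) u)) :
    comp (RG G P) (qAnti n κ' u) x z v () * P z q () w = 0 := by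
  have hz' : ¬ blk (n - 1) z = blk (n - 1) u := fun h => hz (mem_B.2 h)
  rw [comp_qAnti_apply, if_neg hz', zero_mul, sub_zero, qJet_eq_zero κ' u n (y := blk (n - 1) u) (x := z) (fun h => hz' h.1),
    mul_zero, zero_mul]

omit [NeZero n] in
/-- [folklore] **THE `V`-CORNER OVER `qAnti` IS RANK TWO** (generic `G`, `P`):
`cornerV G P qAnti (x,q) = (Σ_{y∈B} RG(x,y))·(Σ_{z∈B} f(z)·P(z,q)) − (Σ_{y∈B} RG(x,y)·f(y))·(Σ_{z∈B} P(z,q))`. -/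
theorem cornerV_qAnti_apply (G P : MKer 4 Unit) (x q : Site 4) (v w : Unit) :
    cornerV G P (qAnti n κ' u) x q v w =
      (∑ y ∈ B (n - 1) (blk (n - 1) u), RG G P x y v ()) *
          (∑ z ∈ B (n - 1) (blk (n - 1) u), qJet n κ' u (blk (n - 1) u) z * P z q () w)
        - (∑ y ∈ B (n - 1) (blk (n - 1) u), RG G P x y v () * qJet n κ' u (blk (n - 1) u) y) *
          (∑ z ∈ B (n - 1) (blk (n - 1) u), P z q () w) := by
  unfold cornerV
  rw [show comp (comp (RG G P) (qAnti n κ' u)) P x q v w = ∑' z, ∑ f : Unit, comp (RG G P) (qAnti n κ' u) x z v f * P z q f w from rfl]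
  simp only [Finset.univ_unique, PUnit.default_eq_unit, Finset.sum_singleton]
  rw [tsum_eq_sum (s := B (n - 1) (blk (n - 1) u)) (fun z hz => outer_summand_eq_zero n κ' u G P x q v w hz)]
  have e : ∀ z ∈ B (n - 1) (blk (n - 1) u), comp (RG G P) (qAnti n κ' u) x z v () * P z q () w =
      (∑ y ∈ B (n - 1) (blk (n - 1) u), RG G P x y v ()) * (qJet n κ' u (blk (n - 1) u) z * P z q () w)
        - (∑ y ∈ B (n - 1) (blk (n - 1) u), RG G P x y v () * qJet n κ' u (blk (n - 1) u) y) * P z q () w := by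
    intro z hz
    rw [comp_qAnti_apply, if_pos (mem_B.1 hz), one_mul]
    ring
  rw [Finset.sum_congr rfl e, Finset.sum_sub_distrib, ← Finset.mul_sum, ← Finset.mul_sum]

/-! ## §4 On the road: (ii) kills one pair, the survivor shares the needle row with the `Q̇`-corner -/

/-- [folklore] **ON THE ROAD THE `V`-CORNER OVER `qAnti` IS RANK ONE**: with `G := Ggh n a`, `P := Pgt n a` (`0 < a`) the block indicator is
annihilated by `R·G′` (`RdotBlockRange.sum_B_RG_eq_zero`), so
`cornerV (Ggh n a) (Pgt n a) (qAnti n κ′ u) (x,q) = −(Σ_{y∈B} RG(x,y)·f(y)) · (Σ_{z∈B} Pgt(z,q))`. -/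
theorem cornerV_qAnti_apply_road (ha : 0 < a) (x q : Site 4) (v w : Unit) :
    cornerV (Ggh n a) (Pgt n a) (qAnti n κ' u) x q v w =
      -(∑ y ∈ B (n - 1) (blk (n - 1) u), RG (Ggh n a) (Pgt n a) x y v () * qJet n κ' u (blk (n - 1) u) y) *
          (∑ z ∈ B (n - 1) (blk (n - 1) u), Pgt n a z q () w) := by
  have h0 : ∑ y ∈ B (n - 1) (blk (n - 1) u), RG (Ggh n a) (Pgt n a) x y v () = 0 := by
    have := sum_B_RG_eq_zero n ha x (blk (n - 1) u)
    obtain ⟨⟩ := v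
    exact this
  rw [cornerV_qAnti_apply, h0, zero_mul, zero_sub, neg_mul]

/-- [folklore] **THE TWO `Q̇`-SLOT CORNERS COMBINE ROW-WISE** on the road: `cornerV … qAnti (x,q) − cornerJ … Jq (x,q) =
(Σ_{y∈B} RG(x,y)·f(y)) · (kerP (n−1) a q (blk u) − Σ_{z∈B} Pgt n a z q)` — one needle row against the DIFFERENCE of the two block-localised
coarse columns (`CornerJRankOne.cornerJ_apply_eq`). -/
theorem cornerV_qAnti_sub_cornerJ_road (ha : 0 < a) (x q : Site 4) (v w : Unit) :
    cornerV (Ggh n a) (Pgt n a) (qAnti n κ' u) x q v w - cornerJ (Ggh n a) (Pgt n a) (Jq n a κ' u) x q v w =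
      (∑ y ∈ B (n - 1) (blk (n - 1) u), RG (Ggh n a) (Pgt n a) x y v () * qJet n κ' u (blk (n - 1) u) y) *
        (kerP (d := 4) (n - 1) a q (blk (n - 1) u) - ∑ z ∈ B (n - 1) (blk (n - 1) u), Pgt n a z q () w) := by
  rw [cornerV_qAnti_apply_road n a κ' u ha, cornerJ_apply_eq]
  ring

/-! ## §5 Linearity of the `V`-corner in the stencil (finitely supported slots) -/

/-- [folklore] The ghost current is supported on the two sites of its bond in its first variable. -/
theorem ghCur_eq_zero_of_ne {y : Site 4} (h1 : y ≠ u + unitVec κ') (h2 : y ≠ u) (z : Site 4) (v w : Unit) : ghCur κ' u y z v w = 0 := by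
  rw [ghCur_apply, if_neg (fun h => h1 h.1), if_neg (fun h => h2 h.1), sub_zero]

omit [NeZero n] in
/-- [folklore] **INNER LINEARITY**: `((R∘G′)∘Sgh)(x,z) = cK·((R∘G′)∘ghCur)(x,z) + cQ·((R∘G′)∘qAnti)(x,z)` for any left factor `A` (both slots are
finitely supported in the summation variable, so all three `tsum`s are finite sums). -/
theorem comp_Sgh_apply (A : MKer 4 Unit) (cK cQ : ℝ) (x z : Site 4) (v w : Unit) :
    comp A (Sgh n cK cQ κ' u) x z v w = cK * comp A (ghCur κ' u) x z v w + cQ * comp A (qAnti n κ' u) x z v w := by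
  classical
  unfold comp
  simp only [Finset.univ_unique, PUnit.default_eq_unit, Finset.sum_singleton, Sgh_apply]
  -- the common finite support: the block of the bond together with the two sites of the bond
  set S : Finset (Site 4) := B (n - 1) (blk (n - 1) u) ∪ {u + unitVec κ', u} with hS
  have hK : ∀ y ∉ S, A x y v () * ghCur κ' u y z () w = 0 := by
    intro y hy
    rw [hS, Finset.mem_union, not_or, Finset.mem_insert, Finset.mem_singleton, not_or] at hy
    rw [ghCur_eq_zero_of_ne κ' u hy.2.1 hy.2.2, mul_zero]
  have hQ : ∀ y ∉ S, A x y v () * qAnti n κ' u y z () w = 0 := by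
    intro y hy
    rw [hS, Finset.mem_union, not_or] at hy
    exact summand_qAnti_eq_zero n κ' u A x z v w hy.1
  have hT : ∀ y ∉ S, A x y v () * (cK * ghCur κ' u y z () w + cQ * qAnti n κ' u y z () w) = 0 := by
    intro y hy
    have h1 := hK y hy; have h2 := hQ y hy
    calc A x y v () * (cK * ghCur κ' u y z () w + cQ * qAnti n κ' u y z () w)
        = cK * (A x y v () * ghCur κ' u y z () w) + cQ * (A x y v () * qAnti n κ' u y z () w) := by ring
      _ = 0 := by rw [h1, h2, mul_zero, mul_zero, add_zero]
  rw [tsum_eq_sum (s := S) hT, tsum_eq_sum (s := S) hK, tsum_eq_sum (s := S) hQ, Finset.mul_sum, Finset.mul_sum,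
    ← Finset.sum_add_distrib]
  exact Finset.sum_congr rfl fun y _ => by ring

omit [NeZero n] in
/-- [folklore] The inner compositions vanish off a finite set in their second variable: `(A∘ghCur)(x,z) = 0` unless `z` is a site of the bond … -/
theorem comp_ghCur_eq_zero_of_ne (A : MKer 4 Unit) (x : Site 4) (v w : Unit) {z : Site 4} (h1 : z ≠ u + unitVec κ') (h2 : z ≠ u) :
    comp A (ghCur κ' u) x z v w = 0 := by
  unfold comp
  simp only [Finset.univ_unique, PUnit.default_eq_unit, Finset.sum_singleton]
  have : ∀ y : Site 4, A x y v () * ghCur κ' u y z () w = 0 := by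
    intro y
    rw [ghCur_apply, if_neg (fun h => h2 h.2), if_neg (fun h => h1 h.2), sub_zero, mul_zero]
  simp only [this, tsum_zero]

omit [NeZero n] in
/-- [folklore] … and `(A∘qAnti)(x,z) = 0` unless `z` is in the bond's block. -/
theorem comp_qAnti_eq_zero_of_not_mem (A : MKer 4 Unit) (x : Site 4) (v w : Unit) {z : Site 4} (hz : z ∉ B (n - 1) (blk (n - 1) u)) :
    comp A (qAnti n κ' u) x z v w = 0 := by
  have hz' : ¬ blk (n - 1) z = blk (n - 1) u := fun h => hz (mem_B.2 h)
  rw [comp_qAnti_apply, if_neg hz', zero_mul, sub_zero, qJet_eq_zero κ' u n (y := blk (n - 1) u) (x := z) (fun h => hz' h.1),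
    mul_zero]

omit [NeZero n] in
/-- [folklore] **THE `V`-CORNER IS LINEAR IN THE STENCIL**: `cornerV G P (Sgh n cK cQ κ′ u) (x,q) = cK·cornerV G P (ghCur κ′ u) (x,q) + cQ·cornerV G P (qAnti n κ′ u) (x,q)`
for ANY `G`, `P` — so `Rdot`'s `V`-corner splits into the ghost-kinetic corner (weight `cK`) and the rank-two∕rank-one averaging corner of §3∕§4 (weight `cQ`). -/
theorem cornerV_Sgh_apply (G P : MKer 4 Unit) (cK cQ : ℝ) (x q : Site 4) (v w : Unit) :
    cornerV G P (Sgh n cK cQ κ' u) x q v w = cK * cornerV G P (ghCur κ' u) x q v w + cQ * cornerV G P (qAnti n κ' u) x q v w := by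
  classical
  unfold cornerV
  rw [show comp (comp (RG G P) (Sgh n cK cQ κ' u)) P x q v w = ∑' z, ∑ f : Unit, comp (RG G P) (Sgh n cK cQ κ' u) x z v f * P z q f w from rfl,
    show comp (comp (RG G P) (ghCur κ' u)) P x q v w = ∑' z, ∑ f : Unit, comp (RG G P) (ghCur κ' u) x z v f * P z q f w from rfl,
    show comp (comp (RG G P) (qAnti n κ' u)) P x q v w = ∑' z, ∑ f : Unit, comp (RG G P) (qAnti n κ' u) x z v f * P z q f w from rfl]
  simp only [Finset.univ_unique, PUnit.default_eq_unit, Finset.sum_singleton, comp_Sgh_apply]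
  set S : Finset (Site 4) := B (n - 1) (blk (n - 1) u) ∪ {u + unitVec κ', u} with hS
  have hK : ∀ z ∉ S, comp (RG G P) (ghCur κ' u) x z v () * P z q () w = 0 := by
    intro z hz
    rw [hS, Finset.mem_union, not_or, Finset.mem_insert, Finset.mem_singleton, not_or] at hz
    rw [comp_ghCur_eq_zero_of_ne κ' u (RG G P) x v () hz.2.1 hz.2.2, zero_mul]
  have hQ : ∀ z ∉ S, comp (RG G P) (qAnti n κ' u) x z v () * P z q () w = 0 := by
    intro z hz
    rw [hS, Finset.mem_union, not_or] at hz
    rw [comp_qAnti_eq_zero_of_not_mem n κ' u (RG G P) x v () hz.1, zero_mul]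
  have hT : ∀ z ∉ S, (cK * comp (RG G P) (ghCur κ' u) x z v () + cQ * comp (RG G P) (qAnti n κ' u) x z v ()) * P z q () w = 0 := by
    intro z hz
    have h1 := hK z hz; have h2 := hQ z hz
    calc (cK * comp (RG G P) (ghCur κ' u) x z v () + cQ * comp (RG G P) (qAnti n κ' u) x z v ()) * P z q () w
        = cK * (comp (RG G P) (ghCur κ' u) x z v () * P z q () w) + cQ * (comp (RG G P) (qAnti n κ' u) x z v () * P z q () w) := by ring
      _ = 0 := by rw [h1, h2, mul_zero, mul_zero, add_zero]
  rw [tsum_eq_sum (s := S) hT, tsum_eq_sum (s := S) hK, tsum_eq_sum (s := S) hQ, Finset.mul_sum, Finset.mul_sum,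
    ← Finset.sum_add_distrib]
  exact Finset.sum_congr rfl fun z _ => by ring

/-! ## §6 The ghost-kinetic corner is a dipole; the stripped projector jet entrywise -/

/-- [folklore] **LEFT COMPOSITION WITH THE GHOST CURRENT**: `(A∘ghCur)(x,z) = A(x, u+e_κ′)·[z = u] − A(x,u)·[z = u+e_κ′]`. -/
theorem comp_ghCur_apply (A : MKer 4 Unit) (x z : Site 4) (v w : Unit) :
    comp A (ghCur κ' u) x z v w =
      A x (u + unitVec κ') v () * (if z = u then 1 else 0) - A x u v () * (if z = u + unitVec κ' then 1 else 0) := by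
  classical
  unfold comp
  simp only [Finset.univ_unique, PUnit.default_eq_unit, Finset.sum_singleton]
  have hne : (u + unitVec κ' : Site 4) ≠ u := fun h =>
    GhostStencil.unitVec_ne_zero κ' (add_left_cancel (show u + unitVec κ' = u + 0 by rw [add_zero]; exact h))
  rw [tsum_eq_sum (s := ({u + unitVec κ', u} : Finset (Site 4)))
    (fun y hy => by
      rw [Finset.mem_insert, Finset.mem_singleton, not_or] at hy
      rw [ghCur_eq_zero_of_ne κ' u hy.1 hy.2, mul_zero]),
    Finset.sum_pair hne]
  simp only [ghCur_apply, true_and, hne, false_and, if_false, sub_zero, zero_sub, hne.symm, mul_neg]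
  ring

omit [NeZero n] in
/-- [folklore] **THE GHOST-KINETIC `V`-CORNER IS A DIPOLE** (rank two, two explicit entries per bond):
`cornerV G P (ghCur κ′ u) (x,q) = RG(x, u+e_κ′)·P(u,q) − RG(x,u)·P(u+e_κ′,q)`. -/
theorem cornerV_ghCur_apply (G P : MKer 4 Unit) (x q : Site 4) (v w : Unit) :
    cornerV G P (ghCur κ' u) x q v w =
      RG G P x (u + unitVec κ') v () * P u q () w - RG G P x u v () * P (u + unitVec κ') q () w := by
  classical
  unfold cornerV
  rw [show comp (comp (RG G P) (ghCur κ' u)) P x q v w = ∑' z, ∑ f : Unit, comp (RG G P) (ghCur κ' u) x z v f * P z q f w from rfl]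
  simp only [Finset.univ_unique, PUnit.default_eq_unit, Finset.sum_singleton]
  have hne : (u + unitVec κ' : Site 4) ≠ u := fun h =>
    GhostStencil.unitVec_ne_zero κ' (add_left_cancel (show u + unitVec κ' = u + 0 by rw [add_zero]; exact h))
  rw [tsum_eq_sum (s := ({u + unitVec κ', u} : Finset (Site 4)))
    (fun z hz => by
      rw [Finset.mem_insert, Finset.mem_singleton, not_or] at hz
      rw [comp_ghCur_eq_zero_of_ne κ' u (RG G P) x v () hz.1 hz.2, zero_mul]),
    Finset.sum_pair hne, comp_ghCur_apply, comp_ghCur_apply]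
  simp only [hne, hne.symm, if_true, if_false, mul_one, mul_zero, sub_zero, zero_sub]
  ring

/-- [folklore] **THE STRIPPED PROJECTOR JET `Rdot` ENTRYWISE** (`0 < a`): with `RG := RG (Ggh n a) (Pgt n a)`, the dipole
`D(x,q) := RG(x,u+e_κ′)·Pgt(u,q) − RG(x,u)·Pgt(u+e_κ′,q)`, the needle row `row(x) := Σ_{y∈B} RG(x,y)·qJet n κ′ u (blk u) y`, the block column
`colP(q) := Σ_{z∈B} Pgt(z,q)` and the `kerP` column `kerP(q, blk u)`:
`Rdot n a cK cQ κ′ u (x,q) = cK·(D(x,q) − D(q,x)) − row(x)·(cQ·colP(q) − kerP(q, blk u)) + row(q)·(cQ·colP(x) − kerP(x, blk u))` —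
one dipole and ONE needle row against ONE combined coarse column, antisymmetrised. -/
theorem Rdot_apply_road (ha : 0 < a) (cK cQ : ℝ) (x q : Site 4) (v w : Unit) :
    RProjectorJet.Rdot n a cK cQ κ' u x q v w =
      cK * ((RG (Ggh n a) (Pgt n a) x (u + unitVec κ') v () * Pgt n a u q () w
              - RG (Ggh n a) (Pgt n a) x u v () * Pgt n a (u + unitVec κ') q () w)
            - (RG (Ggh n a) (Pgt n a) q (u + unitVec κ') w () * Pgt n a u x () v
              - RG (Ggh n a) (Pgt n a) q u w () * Pgt n a (u + unitVec κ') x () v))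
        - (∑ y ∈ B (n - 1) (blk (n - 1) u), RG (Ggh n a) (Pgt n a) x y v () * qJet n κ' u (blk (n - 1) u) y) *
            (cQ * (∑ z ∈ B (n - 1) (blk (n - 1) u), Pgt n a z q () w) - kerP (d := 4) (n - 1) a q (blk (n - 1) u))
        + (∑ y ∈ B (n - 1) (blk (n - 1) u), RG (Ggh n a) (Pgt n a) q y w () * qJet n κ' u (blk (n - 1) u) y) *
            (cQ * (∑ z ∈ B (n - 1) (blk (n - 1) u), Pgt n a z x () v) - kerP (d := 4) (n - 1) a x (blk (n - 1) u)) := by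
  rw [RProjectorJet.Rdot_def, RProjectorJet.rdotOf_def]
  show (cornerV (Ggh n a) (Pgt n a) (Sgh n cK cQ κ' u) x q v w - trK (cornerV (Ggh n a) (Pgt n a) (Sgh n cK cQ κ' u)) x q v w)
      - (cornerJ (Ggh n a) (Pgt n a) (Jq n a κ' u) x q v w - trK (cornerJ (Ggh n a) (Pgt n a) (Jq n a κ' u)) x q v w) = _
  rw [trK_apply, trK_apply, cornerV_Sgh_apply, cornerV_Sgh_apply, cornerV_ghCur_apply, cornerV_ghCur_apply,
    cornerV_qAnti_apply_road n a κ' u ha, cornerV_qAnti_apply_road n a κ' u ha, cornerJ_apply_eq, cornerJ_apply_eq]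
  ring

end

end Summit.QuantumFields.BalabanUV.Beta.D1BFx.CornerVBlockRank
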